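import Literature.Geometry.ComplexAnalytic.PhamBrieskornCyclicNodeLocalisation
import HarnessLib

/-!
# The local-monodromy datum from a geometric monodromy supported in a ball: HOMOLOGICAL form of the interface
# (the local piece need only map to the model Milnor fibre injectively on `H₂`, intertwining the monodromies up to homotopy)

Layer `Literature/Geometry/ComplexAnalytic`; theorems only (no definition, no named fact). Written by the prover seat
`hodge-nonav-prover-Ax` (g10) for crux K1 of the route `Summits/HodgeConjecture/HodgeConjecture/Theses/CyclicUnitaryPowers.lean`
(programme "localisation of the nodal meridian monodromy", discharge of the cited fact
`HodgeTheory.carlsonToledo1999_nodalMeridianLocalMonodromyBound`).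

The sibling `PhamBrieskornCyclicNodeLocalisation` proves the conclusion of that fact — `∃ V, (T − 1)H² ⊆ V`,
`Σ_{i<p} T^i|_V = 0`, `dim V ≤ p − 1` — for `T = h^*`, `h : Y → Y` the identity on an open `B` and preserving an open `A`
with `A ∪ B = Y`, PROVIDED `A` is HOMEOMORPHIC to the affine Milnor fibre `F = {z₀² + z₁² + z₂^p = 1}` by a homeomorphism
conjugating `h|_A` to the model monodromy EXACTLY. The geometric monodromy of the pencil `x₃^p = f₁ + c·g` produced by
flows (AGZV II §1.1) does not come in that form: its ball piece `A` is the LOCAL Milnor fibre `{z₀²+z₁²+z₂^p = ε} ∩ B_r`, which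
maps into `F` (rescaling and inclusion) by a map that is only a homotopy equivalence, and `h|_A` is only HOMOTOPIC (through the
one-parameter family of flows interpolating the cut-off) to the conjugate of the model rotation. This file records the
interface in the generality those constructions deliver:

* `exists_localisation_of_homological_bound` — pure algebraic topology over a field `𝔽`, any degree `n`: if
  `dim H_n(A; 𝔽) ≤ m` and `Σ_{i<q} (h|_A)_*^i = 0` on `H_n(A; 𝔽)`, then `V := (T − 1)Hⁿ(Y; 𝔽)` has `(T − 1)Hⁿ ⊆ V`,
  `Σ_{i<q} T^i|_V = 0`, `dim V ≤ m` (excision localisation `HomologySelfMapFixingOpenSet` + Kronecker transfer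
  `CohomologySelfMapTransferOfField`, exactly as in the sibling);
* `finite_and_finrank_le_and_sum_pow_eq_zero_of_homotopyConj` — transfer of the two homological hypotheses along a map
  `e : A → F` injective on `H_n` with `e ∘ g ≃ μ ∘ e` (homotopic): `dim H_n(A) ≤ dim H_n(F)` and polynomial relations of
  `μ_*` pass to `g_*`;
* **`exists_localisation_of_homotopyConj_modelMonodromy`** — the cyclic-node instance: `e : A → F` injective on
  `H₂(·; ℚ)`, `e ∘ h|_A ≃ (−z₀, −z₁, ζ z₂) ∘ e` ⟹ the conclusion of the cited fact for every `T` acting as `h^*` on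
  `H²(Y; ℚ)`; and `…_rotate` — the same with the rotation `(z₀, z₁, ζ z₂)` as model (the sign pair is homotopic to the
  identity on `F`, `negPairFibre_homotopic_id`).

## References

* [ArnoldGuseinzadeVarchenko2012] V. I. Arnold, S. M. Gusein-Zade, A. N. Varchenko, Singularities of Differentiable Maps,
  Vol. 2, Part I §1.1 (the monodromy is the identity off the ball; held text p0013, p0025), §2.3 Thm. 2.2.
* [Milnor1968] J. Milnor, Singular points of complex hypersurfaces, §9 Thm. 9.1, Lemma 9.4.
* [CarlsonToledo1999] J. A. Carlson, D. Toledo, Duke Math. J. 97 (1999), §6 (kdoublept) (held text p0013–p0014).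
* [HatcherAT2002] A. Hatcher, Algebraic Topology, §2.1 Thm. 2.10, Thm. 2.20, §3.1 p. 201.
-/

noncomputable section

open Complex ContinuousMap CategoryTheory Set
open Literature.AlgebraicTopology.SingularHomology

namespace Literature.Geometry.ComplexAnalytic

namespace PhamBrieskorn

/-! ### Pure algebraic topology: localisation from homological data of the ball piece -/

section General

variable (𝔽 : Type) [Field 𝔽] {Y : Type} [TopologicalSpace Y]

/-- **Localisation of `h^*` from homological data of the invariant piece.** Let `Y = A ∪ B` (open), `h : Y → Y` the
identity on `B`, `h(A) ⊆ A` with restriction `h_A`. If `H_n(A; 𝔽)` is finite-dimensional of dimension `≤ m` and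
`Σ_{i<q} (h_A)_*^i = 0` on it, then every automorphism `T` of `Hⁿ(Y; 𝔽)` acting as `h^*` admits a subspace `V`
(namely `(T − 1)Hⁿ`) with `T x − x ∈ V`, `Σ_{i<q} T^i|_V = 0` and `dim V ≤ m`. (The monodromy "is the identity off the
ball", so `T − 1` factors through the homology of the ball piece: AGZV II §1.1, `h_* = id + var ∘ i_*`.)
[cite: ArnoldGuseinzadeVarchenko2012, Part I §1.1 (held text p0013, p0025)] [cite: HatcherAT2002, §2.1 Thm. 2.20, §3.1 p. 201] -/
theorem exists_localisation_of_homological_bound (n : ℕ) {m q : ℕ}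
    {A B : Set Y} (hAo : IsOpen A) (hBo : IsOpen B) (hAB : A ∪ B = univ)
    (h : C(Y, Y)) (hB : ∀ y ∈ B, h y = y) (hA : C(↥A, ↥A)) (hhA : ∀ a : ↥A, ((hA a : ↥A) : Y) = h a)
    [Module.Finite 𝔽 (singularHomology 𝔽 𝔽 (↥A) n)]
    (hdim : Module.finrank 𝔽 (singularHomology 𝔽 𝔽 (↥A) n) ≤ m)
    (hsum : ∀ a : singularHomology 𝔽 𝔽 (↥A) n,
      ∑ i ∈ Finset.range q, ((singularHomology.map 𝔽 𝔽 hA n).hom ^ i) a = 0)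
    (T : singularCohomology 𝔽 𝔽 Y n ≃ₗ[𝔽] singularCohomology 𝔽 𝔽 Y n)
    (hT : ∀ x, T x = (singularCohomology.map 𝔽 𝔽 h n).hom x) :
    ∃ V : Submodule 𝔽 (singularCohomology 𝔽 𝔽 Y n),
      (∀ x, T x - x ∈ V) ∧ (∀ v ∈ V, (∑ i ∈ Finset.range q, (T ^ i) v) = 0) ∧ Module.finrank 𝔽 V ≤ m := by
  have hmaps : Set.MapsTo h A A := fun a ha => by
    have := (hA ⟨a, ha⟩).2
    rwa [hhA ⟨a, ha⟩] at this
  -- powers of `T` are powers of `h^*`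
  have hTi : ∀ (i : ℕ) (x : singularCohomology 𝔽 𝔽 Y n),
      (T ^ i) x = ((singularCohomology.map 𝔽 𝔽 h n).hom ^ i) x := by
    intro i
    induction i with
    | zero => intro x; rw [pow_zero, pow_zero, Module.End.one_apply]; rfl
    | succ i ih => intro x; rw [pow_succ, pow_succ, LinearEquiv.mul_apply, Module.End.mul_apply, hT, ih]
  have hsumA : ∀ a : singularHomology 𝔽 𝔽 (↥A) n,
      ∑ i ∈ Finset.range q, (1 : 𝔽) • ((singularHomology.map 𝔽 𝔽 hA n).hom ^ i) a = 0 := fun a => by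
    simpa only [one_smul] using hsum a
  refine ⟨LinearMap.range ((singularCohomology.map 𝔽 𝔽 h n).hom - LinearMap.id), fun x => ⟨x, ?_⟩, ?_, ?_⟩
  · rw [LinearMap.sub_apply, LinearMap.id_apply, hT]
  · rintro _ ⟨x, rfl⟩
    rw [Finset.sum_congr rfl fun i _ => hTi i _]
    have h0 := sum_smul_pow_cohomologyMap_apply_sub_eq_zero 𝔽 h n q (fun _ => (1 : 𝔽))
      (fun z => singularHomology.sum_smul_pow_map_sub_self_eq_zero_of_eqOn 𝔽 𝔽 hAo hBo hAB h hB hA hhA n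
        (fun _ => (1 : 𝔽)) hsumA z) x
    simpa only [one_smul, LinearMap.sub_apply, LinearMap.id_apply] using h0
  · rw [finrank_range_cohomologyMap_sub_id_eq]
    exact (singularHomology.finrank_range_sub_id_le_of_eqOn 𝔽 𝔽 hAo hBo hAB h hB hmaps n).trans hdim

/-- **Transfer of the homological data along a map that is injective on homology and intertwines up to homotopy.**
If `e : A → F` induces an injection `H_n(A; 𝔽) → H_n(F; 𝔽)`, `H_n(F; 𝔽)` is finite-dimensional, and `e ∘ g` is
homotopic to `μ ∘ e`, then `H_n(A; 𝔽)` is finite-dimensional with `dim H_n(A) ≤ dim H_n(F)`, and every polynomial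
relation `Σ_{i<q} c_i μ_*^i = 0` on `H_n(F)` gives `Σ_{i<q} c_i g_*^i = 0` on `H_n(A)` (homotopy invariance,
`e_* g_*^i = μ_*^i e_*`). [cite: HatcherAT2002, §2.1 Thm. 2.10] -/
theorem finite_and_finrank_le_and_sum_smul_pow_eq_zero_of_homotopyConj (n : ℕ) {A F : Type} [TopologicalSpace A]
    [TopologicalSpace F] (e : C(A, F)) (g : C(A, A)) (μ : C(F, F)) (hconj : (e.comp g).Homotopic (μ.comp e))
    (hinj : Function.Injective (singularHomology.map 𝔽 𝔽 e n).hom)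
    [Module.Finite 𝔽 (singularHomology 𝔽 𝔽 F n)] :
    Module.Finite 𝔽 (singularHomology 𝔽 𝔽 A n) ∧
      Module.finrank 𝔽 (singularHomology 𝔽 𝔽 A n) ≤ Module.finrank 𝔽 (singularHomology 𝔽 𝔽 F n) ∧
      ∀ (q : ℕ) (c : ℕ → 𝔽),
        (∀ y : singularHomology 𝔽 𝔽 F n, ∑ i ∈ Finset.range q, c i • ((singularHomology.map 𝔽 𝔽 μ n).hom ^ i) y = 0) →
        ∀ a : singularHomology 𝔽 𝔽 A n, ∑ i ∈ Finset.range q, c i • ((singularHomology.map 𝔽 𝔽 g n).hom ^ i) a = 0 := by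
  let eH : singularHomology 𝔽 𝔽 A n →ₗ[𝔽] singularHomology 𝔽 𝔽 F n := (singularHomology.map 𝔽 𝔽 e n).hom
  have hfin : Module.Finite 𝔽 (singularHomology 𝔽 𝔽 A n) :=
    Module.Finite.of_injective eH hinj
  refine ⟨hfin, LinearMap.finrank_le_finrank_of_injective (f := eH) hinj, fun q c hμ a => ?_⟩
  -- `e_* ∘ g_* = μ_* ∘ e_*`
  have hstep : ∀ x : singularHomology 𝔽 𝔽 A n,
      eH ((singularHomology.map 𝔽 𝔽 g n).hom x) = (singularHomology.map 𝔽 𝔽 μ n).hom (eH x) := by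
    intro x
    change (singularHomology.map 𝔽 𝔽 g n ≫ singularHomology.map 𝔽 𝔽 e n) x =
      (singularHomology.map 𝔽 𝔽 e n ≫ singularHomology.map 𝔽 𝔽 μ n) x
    rw [← singularHomology.map_comp, ← singularHomology.map_comp, singularHomology.map_eq_of_homotopic 𝔽 𝔽 hconj]
  have hpow : ∀ (i : ℕ) (x : singularHomology 𝔽 𝔽 A n),
      eH (((singularHomology.map 𝔽 𝔽 g n).hom ^ i) x) = ((singularHomology.map 𝔽 𝔽 μ n).hom ^ i) (eH x) := by
    intro i
    induction i with
    | zero => intro x; rw [pow_zero, pow_zero, Module.End.one_apply, Module.End.one_apply]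
    | succ i ih => intro x; rw [pow_succ', pow_succ', Module.End.mul_apply, Module.End.mul_apply, hstep, ih]
  apply hinj
  change eH _ = eH 0
  rw [map_zero, map_sum, Finset.sum_congr rfl fun i _ => by rw [map_smul, hpow i a]]
  exact hμ (eH a)

end General

/-! ### The cyclic node: the interface with a homotopy-conjugacy to the model -/

section CyclicNode

variable (p : ℕ) {Y : Type} [TopologicalSpace Y]

/-- **The localisation principle, homotopy form, for the cyclic node `(2, 2, p)`** (AGZV II §1.1 + Milnor Thm. 9.1 + CT99
§6 (kdoublept)). `Y = A ∪ B` open, `h : Y → Y` the identity on `B`, `h(A) ⊆ A` with restriction `h_A`; `e : A → F` a map to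
the affine Milnor fibre `F = {z₀² + z₁² + z₂^p = 1}` which is INJECTIVE on `H₂(·; ℚ)` (e.g. the composite of a
homeomorphism onto a local Milnor fibre `{P = ε} ∩ B_r`, the weighted rescaling to `{P = 1}` and the inclusion — a homotopy
equivalence) and intertwines `h_A` with the model monodromy `(z₀, z₁, z₂) ↦ (−z₀, −z₁, ζ z₂)` UP TO HOMOTOPY (`ζ` a
primitive `p`-th root of unity, `p ≥ 2`). Then every automorphism `T` of `H²(Y; ℚ)` acting as `h^*` admits a subspace `V`
with `T x − x ∈ V`, `Σ_{i<p} T^i = 0` on `V` and `dim V ≤ p − 1` — the conclusion of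
`HodgeTheory.carlsonToledo1999_nodalMeridianLocalMonodromyBound` for `T`.
[cite: ArnoldGuseinzadeVarchenko2012, Part I §1.1 (held text p0013, p0025)] [cite: Milnor1968, §9 Thm. 9.1]
[cite: CarlsonToledo1999, §6 (kdoublept) (held text p0013)] -/
theorem exists_localisation_of_homotopyConj_modelMonodromy (hp : 2 ≤ p) {ζ : ℂ} (hζ : IsPrimitiveRoot ζ p)
    {A B : Set Y} (hAo : IsOpen A) (hBo : IsOpen B) (hAB : A ∪ B = univ)
    (h : C(Y, Y)) (hB : ∀ y ∈ B, h y = y) (hA : C(↥A, ↥A)) (hhA : ∀ a : ↥A, ((hA a : ↥A) : Y) = h a)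
    (e : C(↥A, fibre (cyclicNodeExponents p)))
    (hinj : Function.Injective (singularHomology.map ℚ ℚ e 2).hom)
    (hconj : (e.comp hA).Homotopic
      (ContinuousMap.comp
        (ContinuousMap.comp
          (negPairFibre (cyclicNodeExponents p) (i := 0) (j := 1) (by decide) rfl rfl :
            C(fibre (cyclicNodeExponents p), fibre (cyclicNodeExponents p)))
          (rotateFibre (cyclicNodeExponents p) (cyclicNodeExponents_ne_zero p (by omega))
            (⟨ζ, hζ.pow_eq_one⟩ : Omega (cyclicNodeExponents p (Fin.last 2))) :
            C(fibre (cyclicNodeExponents p), fibre (cyclicNodeExponents p))))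
        e))
    (T : singularCohomology ℚ ℚ Y 2 ≃ₗ[ℚ] singularCohomology ℚ ℚ Y 2)
    (hT : ∀ x, T x = (singularCohomology.map ℚ ℚ h 2).hom x) :
    ∃ V : Submodule ℚ (singularCohomology ℚ ℚ Y 2),
      (∀ x, T x - x ∈ V) ∧ (∀ v ∈ V, (∑ i ∈ Finset.range p, (T ^ i) v) = 0) ∧ Module.finrank ℚ V ≤ p - 1 := by
  haveI hFfin : Module.Finite ℚ (singularHomology ℚ ℚ (fibre (cyclicNodeExponents p)) 2) :=
    finite_rat_singularHomology_fibre (a := cyclicNodeExponents p) (cyclicNodeExponents_ne_zero p (by omega))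
      (two_le_cyclicNodeExponents p hp)
  obtain ⟨hfinA, hdimA, hrel⟩ :=
    finite_and_finrank_le_and_sum_smul_pow_eq_zero_of_homotopyConj ℚ 2 e hA _ hconj hinj
  haveI := hfinA
  have hdim : Module.finrank ℚ (singularHomology ℚ ℚ (↥A) 2) ≤ p - 1 := by
    rw [← finrank_rat_singularHomology_fibre_cyclicNode p (by omega)]
    exact hdimA
  have hsum : ∀ a : singularHomology ℚ ℚ (↥A) 2,
      ∑ i ∈ Finset.range p, ((singularHomology.map ℚ ℚ hA 2).hom ^ i) a = 0 := by
    intro a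
    have h1 := hrel p (fun _ => (1 : ℚ)) (fun y => ?_) a
    · simpa only [one_smul] using h1
    · simp only [one_smul]
      rw [map_modelMonodromy_eq_map_rotateFibre p ℚ (by omega)]
      exact sum_pow_map_rotateFibre_eq_zero ℚ (cyclicNodeExponents_ne_zero p (by omega))
        (a := cyclicNodeExponents p) (ζ := ζ) hζ y
  exact exists_localisation_of_homological_bound ℚ 2 hAo hBo hAB h hB hA hhA hdim hsum T hT

/-- **The same with the ROTATION `(z₀, z₁, z₂) ↦ (z₀, z₁, ζ z₂)` as model** (on `F` the sign pair `(−z₀, −z₁, z₂)` is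
homotopic to the identity through the plane rotations, `negPairFibre_homotopic_id`, so a homotopy-conjugacy to the rotation
is as good as one to the model monodromy). [cite: Milnor1968, §9 Thm. 9.1 and Lemma 9.4]
[cite: CarlsonToledo1999, §6 (kdoublept) (held text p0013)] -/
theorem exists_localisation_of_homotopyConj_rotate (hp : 2 ≤ p) {ζ : ℂ} (hζ : IsPrimitiveRoot ζ p)
    {A B : Set Y} (hAo : IsOpen A) (hBo : IsOpen B) (hAB : A ∪ B = univ)
    (h : C(Y, Y)) (hB : ∀ y ∈ B, h y = y) (hA : C(↥A, ↥A)) (hhA : ∀ a : ↥A, ((hA a : ↥A) : Y) = h a)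
    (e : C(↥A, fibre (cyclicNodeExponents p)))
    (hinj : Function.Injective (singularHomology.map ℚ ℚ e 2).hom)
    (hconj : (e.comp hA).Homotopic
      (ContinuousMap.comp
        (rotateFibre (cyclicNodeExponents p) (cyclicNodeExponents_ne_zero p (by omega))
          (⟨ζ, hζ.pow_eq_one⟩ : Omega (cyclicNodeExponents p (Fin.last 2))) :
          C(fibre (cyclicNodeExponents p), fibre (cyclicNodeExponents p)))
        e))
    (T : singularCohomology ℚ ℚ Y 2 ≃ₗ[ℚ] singularCohomology ℚ ℚ Y 2)
    (hT : ∀ x, T x = (singularCohomology.map ℚ ℚ h 2).hom x) :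
    ∃ V : Submodule ℚ (singularCohomology ℚ ℚ Y 2),
      (∀ x, T x - x ∈ V) ∧ (∀ v ∈ V, (∑ i ∈ Finset.range p, (T ^ i) v) = 0) ∧ Module.finrank ℚ V ≤ p - 1 := by
  haveI hFfin : Module.Finite ℚ (singularHomology ℚ ℚ (fibre (cyclicNodeExponents p)) 2) :=
    finite_rat_singularHomology_fibre (a := cyclicNodeExponents p) (cyclicNodeExponents_ne_zero p (by omega))
      (two_le_cyclicNodeExponents p hp)
  obtain ⟨hfinA, hdimA, hrel⟩ :=
    finite_and_finrank_le_and_sum_smul_pow_eq_zero_of_homotopyConj ℚ 2 e hA _ hconj hinj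
  haveI := hfinA
  have hdim : Module.finrank ℚ (singularHomology ℚ ℚ (↥A) 2) ≤ p - 1 := by
    rw [← finrank_rat_singularHomology_fibre_cyclicNode p (by omega)]
    exact hdimA
  have hsum : ∀ a : singularHomology ℚ ℚ (↥A) 2,
      ∑ i ∈ Finset.range p, ((singularHomology.map ℚ ℚ hA 2).hom ^ i) a = 0 := by
    intro a
    have h1 := hrel p (fun _ => (1 : ℚ)) (fun y => ?_) a
    · simpa only [one_smul] using h1
    · simp only [one_smul]
      exact sum_pow_map_rotateFibre_eq_zero ℚ (cyclicNodeExponents_ne_zero p (by omega))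
        (a := cyclicNodeExponents p) (ζ := ζ) hζ y
  exact exists_localisation_of_homological_bound ℚ 2 hAo hBo hAB h hB hA hhA hdim hsum T hT

end CyclicNode

end PhamBrieskorn

end Literature.Geometry.ComplexAnalytic

end
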